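import Summits.Ventures.QEC.Census.RefinedIPCertificateGridSound
import HarnessLib

/-!
# Refined certificates on the evaluation grid: power rows (kernel-cheaper node tables), same checker semantics

Venture QEC (cell `qec`, rung X1; row 06). `RefinedIPCertificateGrid.lean` builds the node tables of the y-parts
`y₀^{w−b−c} y₁^{b} y₂^{c}` entry by entry with `^`; at `w₀ = 22` (the β cell `(22,14)`) the `23 × 23 × 276` power
chains exhaust the kernel («excessive memory consumption», measured). This file computes the SAME tables from
precomputed power rows `[x⁰, …, xʷ]` (two products per entry) and proves the resulting tables, leaf check and tree
check EQUAL to those of `RefinedIPCertificateGrid(Sound).lean` (`nodeTabF_eq`, `gridTabF_eq`, `rleafOKF_eq`,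
`checkPathF_eq`), so soundness transfers verbatim: `not_crssRefinedFeasible_of_checkF`. HONEST FRAMING: a
re-implementation of a pure function with an equality proof; nothing here certifies a distance.
[cite: CalderbankEtAl1998, §7 (ii) (printed p. 28)]; [cite: MacWilliamsSloane1977, Ch. 17 §4 Thm. 20].
-/

namespace Summit.Ventures.QEC.Census

open Finset Literature.InformationTheory.QuantumCodes

/-! ### 1. Power rows -/

/-- `[acc, acc·x, acc·x², …]` with `n + 1` entries (running products). [folklore] -/
def powRowAux (x : ℤ) : ℕ → ℤ → List ℤ
  | 0, acc => [acc]
  | n + 1, acc => acc :: powRowAux x n (acc * x)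

/-- The power row `[x⁰, x¹, …, xⁿ]`. [folklore] -/
def powRow (x : ℤ) (n : ℕ) : List ℤ := powRowAux x n 1

/-- Lookup in `powRowAux`. [folklore] -/
theorem powRowAux_getD (x : ℤ) : ∀ (n : ℕ) (acc : ℤ) (i : ℕ), i ≤ n → (powRowAux x n acc).getD i 0 = acc * x ^ i
  | 0, acc, i, hi => by
    obtain rfl : i = 0 := Nat.le_zero.1 hi
    simp [powRowAux]
  | n + 1, acc, 0, _ => by simp [powRowAux]
  | n + 1, acc, i + 1, hi => by
    simp only [powRowAux, List.getD_cons_succ]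
    rw [powRowAux_getD x n (acc * x) i (by omega)]
    ring

/-- Lookup in a power row: `[x⁰,…,xⁿ][i] = xⁱ` for `i ≤ n`. [folklore] -/
theorem powRow_getD (x : ℤ) {n i : ℕ} (hi : i ≤ n) : (powRow x n).getD i 0 = x ^ i := by
  rw [powRow, powRowAux_getD x n 1 i hi, one_mul]

/-! ### 2. The node tables from power rows -/

/-- The y-part table of one node, from three power rows. [folklore] -/
def nodeTabF (w : ℕ) (y : ℤ × ℤ × ℤ) : List (List ℤ) :=
  let Y0 := powRow y.1 w
  let Y1 := powRow y.2.1 w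
  let Y2 := powRow y.2.2 w
  (List.range (w + 1)).map fun b => (List.range (w + 1)).map fun c => Y0.getD (w - b - c) 0 * Y1.getD b 0 * Y2.getD c 0

/-- `map` over `range` only depends on the values below the bound. [folklore] -/
private theorem map_range_congr {α : Type*} (n : ℕ) {f g : ℕ → α} (h : ∀ i, i < n → f i = g i) :
    (List.range n).map f = (List.range n).map g :=
  List.map_congr_left fun i hi => h i (List.mem_range.1 hi)

/-- **The fast node table equals the reference one.** [folklore] -/
theorem nodeTabF_eq (w : ℕ) (y : ℤ × ℤ × ℤ) : nodeTabF w y = nodeTab w y := by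
  simp only [nodeTabF, nodeTab, tab2]
  refine map_range_congr _ fun b hb => map_range_congr _ fun c hc => ?_
  rw [powRow_getD _ (by omega), powRow_getD _ (by omega), powRow_getD _ (by omega), yPart]

/-- The inner table from fast node tables. [folklore] -/
def innerTabF (w : ℕ) (ys : List (ℤ × ℤ × ℤ)) (mu : List ℤ) : List (List ℤ) :=
  let nts := ys.map (nodeTabF w)
  tab2 w fun b c => (List.zipWith (fun T s => s * get2 T b c) nts mu).sum

/-- `innerTabF = innerTab`. [folklore] -/
theorem innerTabF_eq (w : ℕ) (ys : List (ℤ × ℤ × ℤ)) (mu : List ℤ) : innerTabF w ys mu = innerTab w ys mu := by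
  simp only [innerTabF, innerTab, funext (nodeTabF_eq w)]

/-- The full table from fast inner tables; the x-power table from power rows too. [folklore] -/
def gridTabF (m w : ℕ) (xs : List (ℤ × ℤ)) (ys : List (ℤ × ℤ × ℤ)) (mus : List (List ℤ)) : List (List (List ℤ)) :=
  let xts := xs.map fun x => (List.range (m + 1)).map (xPart m x)
  let its := mus.map (innerTabF w ys)
  tab3 m w fun a b c => (List.zipWith (fun X T => X.getD a 0 * get2 T b c) xts its).sum

/-- `gridTabF = gridTab`. [folklore] -/
theorem gridTabF_eq (m w : ℕ) (xs : List (ℤ × ℤ)) (ys : List (ℤ × ℤ × ℤ)) (mus : List (List ℤ)) :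
    gridTabF m w xs ys mus = gridTab m w xs ys mus := by
  simp only [gridTabF, gridTab, funext (innerTabF_eq w ys)]

/-! ### 3. The leaf and tree checks with fast tables -/

section Check

variable (n k d e w₀ : ℕ)

/-- The grid leaf check with fast tables (otherwise literally `rleafOKG`). Column: definition (ours).
[cite: MacWilliamsSloane1977, Ch. 17 §4 Thm. 20] -/
def rleafOKF (path : List RSplit) (L : RLeafG) : Bool :=
  let TP := gridTabF (n - w₀) w₀ (gridX (n - w₀)) (gridY w₀) L.mus
  let TT := gridTabF (n - w₀) w₀ ((gridX (n - w₀)).map tX) ((gridY w₀).map tY) L.mus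
  decide (w₀ ≤ n) && signsOK (baseRows n k d e) L.base && splitSignsOK path L.smult &&
  ((List.range (n + 1)).all fun j =>
    decide (coefAG n k d e path L j ≤ 0) && decide (coefBG n k d e path L j ≤ 0) &&
      decide (coefWG n k d e path L j ≤ 0)) &&
  ((List.range (n - w₀ + 1)).all fun a => (List.range (w₀ + 1)).all fun b => (List.range (w₀ + 1)).all fun c =>
    (!(decide (d ≤ a + b + c)) || decide (0 ≤ get3 L.kap a b c)) &&
    decide (coefRG w₀ TT path L a b c ≤ 0) && decide (coefRpG n k w₀ TP path L a b c ≤ 0)) &&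
  decide (0 < leafRhsG n k d e path L)

/-- `rleafOKF = rleafOKG`. [folklore] -/
theorem rleafOKF_eq (path : List RSplit) (L : RLeafG) : rleafOKF n k d e w₀ path L = rleafOKG n k d e w₀ path L := by
  simp only [rleafOKF, rleafOKG, gridTabF_eq]

/-- The tree check with fast tables. Column: definition (ours). [cite: MacWilliamsSloane1977, Ch. 17 §4 Thm. 20] -/
def RTreeG.checkPathF : RTreeG → List RSplit → Bool
  | .leaf L, path => rleafOKF n k d e w₀ path L
  | .split ca cb cw cr crp v le ge, path =>
    le.checkPathF (path ++ [⟨ca, cb, cw, cr, crp, v, false⟩]) && ge.checkPathF (path ++ [⟨ca, cb, cw, cr, crp, v, true⟩])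

/-- `checkPathF = checkPath`. [folklore] -/
theorem RTreeG.checkPathF_eq (t : RTreeG) (path : List RSplit) :
    t.checkPathF n k d e w₀ path = t.checkPath n k d e w₀ path := by
  induction t generalizing path with
  | leaf L => simp only [RTreeG.checkPathF, RTreeG.checkPath, rleafOKF_eq]
  | split ca cb cw cr crp v le ge ihl ihg => simp only [RTreeG.checkPathF, RTreeG.checkPath, ihl, ihg]

/-- The fast grid checker for `CRSSRefinedFeasible n k d w₀` in parity branch `e`. Column: definition (ours).
[cite: CalderbankEtAl1998, §7 (ii)] -/
def RTreeG.checkF (t : RTreeG) : Bool := t.checkPathF n k d e w₀ []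

end Check

/-- **Two fast-checked grid certificates refute the refined system** (soundness transferred from
`not_crssRefinedFeasible_of_checkG` through `checkPathF_eq`) — UNCONDITIONAL. Column: proved (ours).
[cite: CalderbankEtAl1998, §7 (ii) (printed p. 28)] -/
theorem not_crssRefinedFeasible_of_checkF {n k d w₀ : ℕ} (t₀ t₁ : RTreeG) (h₀ : t₀.checkF n k d 0 w₀ = true)
    (h₁ : t₁.checkF n k d 1 w₀ = true) : ¬ CRSSRefinedFeasible n k d w₀ := by
  rw [RTreeG.checkF, RTreeG.checkPathF_eq] at h₀ h₁
  exact not_crssRefinedFeasible_of_checkG t₀ t₁ h₀ h₁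

end Summit.Ventures.QEC.Census
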